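import Mathlib.RingTheory.Flat.EquationalCriterion
import Mathlib.Algebra.CharP.Two
import Mathlib.Algebra.CharP.Lemmas
import Literature.AlgebraicGeometry.Resolution.RegularSystemOfParameters

/-!
# Crux `Steer` (stmt-ResolutionOfSingularities-16345), chain W4.1 — SQUARE DESCENT (K-β7 block (c)): the word
# `SquareDescent` VERBATIM and its kernel proof `squareDescent_holds`

OURS (campaign `res-hironaka`, rung L ★L-G4, slot W4.1). The word `SquareDescent` is LEMMA SD of res-L0-w41-idea-1 g10's memo
`CANONICAL-CLEANING-g10.md` §12.2 (the transfer device of the REPAIRED `FormalCentreDescent`, K-β7 with `Odd d`, memo §12.3 (2)),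
typed by idea-1 in `L/res-L0-w41-idea-1/K7Words-idea-1-g10.lean` 9000aedaa13a2063 l.32–39 and hoisted here BYTE FOR BYTE (the `def`
body); audits: res-L0-w41-tri-2 g8 TRIAGE v28 `k7/audit_K7.md` 83bb1ad38ae9a19a row R-K7.4 (paper proof PASS, line by line) and WORD CHECK
2026-08-27T17:02:07Z (2) (word as typed PASS). Filed by res-D-pv-035 g8 on res-L0-w41-plan-1 RULINGS 198(a)/200(e) (tree name of record
`Theorems/FrobeniusClosingSteerSquareDescent.lean`). It is a statement about the route's own bookkeeping — plain commutative algebra —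
and is NOT a statement of the manuscript under review [claim: Hironaka2017, status: under-review]; candidates, not facts; AI-written and
AI-checked only, weaker than expert review.

STATEMENT. `A → B` a flat algebra of local rings (`A` regular local of characteristic `2`, `B` local, `Module.Flat A B`) with
`𝔪_A B = 𝔪_B` and the residue square condition «a `b ∈ B` whose square is congruent to an element of `A` mod `𝔪_B` is itself congruent
to an element of `A` mod `𝔪_B`» (`L ∩ K^{1/2} = K`). THEN for every `n`: an `f ∈ A` that is a square modulo `𝔪_Bⁿ` in `B` is a square
modulo `𝔪_Aⁿ` in `A`. No Noetherian hypothesis on `B` is used.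

KERNEL PROOF (the memo's induction, with the graded algebra replaced by two tree facts and Mathlib's equational criterion of flatness).
Fix a regular system of parameters `x` of `A` (`Literature…exists_regularSystemOfParameters`); `𝔪_B` is generated by its image `x'`.
* `coeff_mem_of_eval_eq_zero` — INDEPENDENCE IN `B`: a form `P ∈ B[X]` of degree `n` with `P(x') = 0` has all coefficients in `𝔪_B`.
  The relation `Σ_m x^m · P_m = 0` (`x^m ∈ A`, `P_m ∈ B`) is TRIVIAL by flatness (`Module.Flat.isTrivialRelation_of_sum_smul_eq_zero`):
  `P_m = Σ_j a_{mj} y_j` with `Σ_m x^m a_{mj} = 0` in `A`; each `Σ_m a_{mj} X^m` is a form of degree `n` killed by `x`, so by the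
  QUASI-REGULARITY of a regular system of parameters (`Literature…coeff_mem_maximalIdeal_of_eval_mem_pow`, Matsumura Thm. 17.10 via
  Rees' Thm. 16.2 — `gr_𝔪(A) ≅ k[X]`) every `a_{mj} ∈ 𝔪_A`, whence `P_m ∈ 𝔪_A B = 𝔪_B`.
* `coeff_mem_of_eval_mem_pow_succ` — the same with `P(x') ∈ 𝔪_B^{n+1}` (move the excess into coefficients: `𝔪_B^{n+1} = 𝔪_B·(x')ⁿ`).
* `mem_pow_of_algebraMap_mem_pow` — FAITHFUL FLATNESS ON POWERS `𝔪_Bⁿ ∩ A = 𝔪_Aⁿ`, by induction on `n` from the previous item.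
* `sq_eval_eq_eval_twist` — FROBENIUS: in characteristic `2`, `H(y)² = T(y)` for the twist `T = Σ_m (H_m X^m)²`, whose coefficient at
  `X^{2m}` is `H_m²`.
* `squareDescent_holds` — the memo's invariant `φ f − φ a² − c² ∈ 𝔪_Bⁿ`, `c ∈ 𝔪_Bʲ`, pushed from `j` to `j + 1` while `2j < n`:
  `g = f − a² ∈ 𝔪_A^{2j}` (faithful flatness), `g = F(x)`, `c = H(x')`, the form `F − T` of degree `2j` lies in `𝔪_B^{2j+1}` at `x'`,
  so `φ F_{2m} ≡ H_m²` mod `𝔪_B` for every `m`; the residue square condition gives `α_m ∈ A` with `H_m ≡ φ α_m`; put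
  `a' = Σ α_m x^m`, `a ↦ a + a'`, `c ↦ c − φ a' ∈ 𝔪_B^{j+1}`; characteristic `2` keeps the invariant (`(a+a')² = a² + a'²`,
  `(c − φa')² = c² + φa'²`). At `j = ⌈n/2⌉`, `c² ∈ 𝔪_Bⁿ` and faithful flatness finishes.
[cite: Matsumura1987, Thm. 17.10, Thm. 16.2, Thm. 7.5] [folklore]
-/

-- `Summit.<S>.<S>.…` duplicates the summit name by design (single-problem summit).
set_option linter.dupNamespace false
set_option autoImplicit false

namespace Summit.ResolutionOfSingularities.ResolutionOfSingularities.Theorems.SwitchingDichotomy.SquareDescent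

open IsLocalRing MvPolynomial
open Literature.AlgebraicGeometry.Resolution (exists_regularSystemOfParameters coeff_mem_maximalIdeal_of_eval_mem_pow
  exists_isHomogeneous_of_mem_mul_span_pow eval_mem_mul_span_pow exists_isHomogeneous_of_mem_span_pow)

/-- SQUARE DESCENT (memo `CANONICAL-CLEANING-g10.md` §12.2, LEMMA SD; typed VERBATIM as idea-1's `K7Words-idea-1-g10.lean` l.32–39).
`A → B` a flat local homomorphism of local rings of characteristic `2` (given as an algebra; locality is implied by `𝔪_A B = 𝔪_B`),
`A` regular local, `𝔪_A B = 𝔪_B`, and the residue extension `K ⊆ L` satisfies `L ∩ K^{1/2} = K` (stated element-wise: a `b ∈ B` whose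
square is congruent to an element of `A` mod `𝔪_B` is itself congruent to an element of `A` mod `𝔪_B`; automatic when `L/K` is
separable). THEN for every `n`: an `f ∈ A` that is a square modulo `𝔪_Bⁿ` in `B` is a square modulo `𝔪_Aⁿ` in `A`. Paper proof:
`gr B = gr A ⊗_K L = L[X₁,…,X_m]`, faithful flatness `𝔪_Bᵏ ∩ A = 𝔪_Aᵏ`, and a graded Frobenius induction (`(Σ λ_α X^α)² = Σ λ_α² X^{2α}`
is `K`-rational iff every `λ_α² ∈ K` iff every `λ_α ∈ K`). Size M. OURS — candidate word invented by res-L0-w41-idea-1 g10 (memo §12.2),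
consumed by the paper proof of the repaired `FormalCentreDescent` (K-β7) and by nothing else; not a statement of the manuscript under
review; provenance in prose only (parameterless Prop). Kernel proof: `squareDescent_holds` below. -/
def SquareDescent : Prop :=
  ∀ (A B : Type) [CommRing A] [CommRing B] [Algebra A B] [IsRegularLocalRing A] [IsLocalRing B]
    [CharP A 2] [Module.Flat A B],
    (maximalIdeal A).map (algebraMap A B) = maximalIdeal B →
    (∀ b : B, (∃ a : A, b ^ 2 - algebraMap A B a ∈ maximalIdeal B) →
      ∃ a : A, b - algebraMap A B a ∈ maximalIdeal B) →
    ∀ (n : ℕ) (f : A) (b : B), algebraMap A B f - b ^ 2 ∈ maximalIdeal B ^ n →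
      ∃ a : A, f - a ^ 2 ∈ maximalIdeal A ^ n

/-! ## Generic bookkeeping: evaluation of forms along an algebra map, the Frobenius twist -/

section Generic

variable {A B : Type} [CommRing A] [CommRing B] [Algebra A B]

/-- `φ (F(x)) = (φ F)(φ ∘ x)` for the structure map `φ = algebraMap A B`. [folklore] -/
theorem algebraMap_eval {σ : Type} (x : σ → A) (F : MvPolynomial σ A) :
    algebraMap A B (eval x F) = eval (algebraMap A B ∘ x) (map (algebraMap A B) F) := by
  rw [eval_map, show eval x F = eval₂ (RingHom.id A) x F from rfl, eval₂_comp_left, RingHom.comp_id]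

/-- `(c·X^m)(y) = c · (X^m)(y)`. [folklore] -/
theorem eval_monomial_eq {R : Type} [CommRing R] {σ : Type} (y : σ → R) (m : σ →₀ ℕ) (c : R) :
    eval y (monomial m c) = c * eval y (monomial m 1) := by
  rw [eval_monomial, eval_monomial, one_mul]

/-- Along a homomorphism of local rings whose extension of `𝔪_A` is `𝔪_B`: `φ a ∈ 𝔪_B ⇒ a ∈ 𝔪_A` (units map to units). [folklore] -/
theorem mem_maximalIdeal_of_algebraMap_mem [IsLocalRing A] [IsLocalRing B] {a : A}
    (h : algebraMap A B a ∈ maximalIdeal B) : a ∈ maximalIdeal A := by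
  rw [IsLocalRing.mem_maximalIdeal, mem_nonunits_iff] at h ⊢
  exact fun hu => h (hu.map _)

/-- Doubling of exponent vectors is injective. [folklore] -/
theorem eq_of_two_nsmul_eq {σ : Type} {m m' : σ →₀ ℕ} (h : 2 • m = 2 • m') : m = m' := by
  ext i
  have := DFunLike.congr_fun h i
  simp only [Finsupp.smul_apply, smul_eq_mul] at this
  omega

/-- The FROBENIUS TWIST `T = Σ_m (H_m X^m)²` of a polynomial `H` over a ring of characteristic `2` evaluates to the square:
`H(y)² = T(y)`. [folklore] -/
theorem sq_eval_eq_eval_twist [CharP B 2] {σ : Type} (y : σ → B) (H : MvPolynomial σ B) :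
    (eval y H) ^ 2 = eval y (∑ m ∈ H.support, (monomial m (H.coeff m)) ^ 2) := by
  haveI : ExpChar B 2 := ExpChar.prime Nat.prime_two
  rw [map_sum]
  simp_rw [map_pow]
  rw [← sum_pow_char 2, ← map_sum, ← H.as_sum]

/-- The twist's coefficient at `X^{2m}` is `H_m²`. [folklore] -/
theorem coeff_two_nsmul_twist {σ : Type} (H : MvPolynomial σ B) (m₀ : σ →₀ ℕ) :
    (∑ m ∈ H.support, (monomial m (H.coeff m)) ^ 2).coeff (2 • m₀) = (H.coeff m₀) ^ 2 := by
  classical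
  simp_rw [monomial_pow]
  rw [coeff_sum]
  simp_rw [coeff_monomial]
  by_cases h : m₀ ∈ H.support
  · rw [Finset.sum_eq_single m₀ (fun m _ hne => if_neg fun e => hne (eq_of_two_nsmul_eq e))
      (fun habs => absurd h habs), if_pos rfl]
  · rw [notMem_support_iff.mp h, Finset.sum_eq_zero fun m hm => if_neg fun e => h ?_]
    · ring
    · rw [← eq_of_two_nsmul_eq e]; exact hm

/-- The twist of a form of degree `j` is a form of degree `2j`. [folklore] -/
theorem isHomogeneous_twist {σ : Type} {H : MvPolynomial σ B} {j : ℕ} (hH : H.IsHomogeneous j) :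
    (∑ m ∈ H.support, (monomial m (H.coeff m)) ^ 2).IsHomogeneous (2 * j) := by
  rw [mul_comm]
  refine IsHomogeneous.sum _ _ _ fun m hm => (isHomogeneous_monomial _ ?_).pow 2
  rw [Finsupp.degree_eq_weight_one]
  exact hH (mem_support_iff.mp hm)

end Generic

/-! ## Independence of the monomials of a regular system of parameters after a flat base change -/

section RSOP

variable {A B : Type} [CommRing A] [CommRing B] [Algebra A B] [IsRegularLocalRing A] [IsLocalRing B]
  {d : ℕ} (hd : (maximalIdeal A).spanFinrank = d) (x : Fin d → A)
  (hx : Ideal.span (Set.range x) = maximalIdeal A)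
  (hmap : (maximalIdeal A).map (algebraMap A B) = maximalIdeal B)

include hx hmap in
/-- `𝔪_B` is generated by the image of the regular system of parameters. [folklore] -/
theorem span_range_comp_eq : Ideal.span (Set.range (algebraMap A B ∘ x)) = maximalIdeal B := by
  rw [Set.range_comp, ← Ideal.map_span, hx, hmap]

include hd hx hmap in
/-- **INDEPENDENCE IN `B`.** For `B` flat over the regular local ring `A` with `𝔪_A B = 𝔪_B`: a form `P ∈ B[X₁,…,X_d]` of degree `n`
with `P(x') = 0` at the image `x'` of a regular system of parameters of `A` has all its coefficients in `𝔪_B`. Proof: Mathlib's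
equational criterion of flatness makes the relation `Σ_m x^m P_m = 0` trivial, and the quasi-regularity of `x` in `A`
(Matsumura Thm. 17.10) puts the `A`-coefficients of the trivialisation in `𝔪_A`. [cite: Matsumura1987, Thm. 17.10, Thm. 7.6] -/
theorem coeff_mem_of_eval_eq_zero [Module.Flat A B] {n : ℕ} {P : MvPolynomial (Fin d) B}
    (hP : P.IsHomogeneous n) (h0 : eval (algebraMap A B ∘ x) P = 0) (m : Fin d →₀ ℕ) :
    P.coeff m ∈ maximalIdeal B := by
  classical
  set S := P.support with hSdef
  by_cases hmS : m ∈ S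
  swap
  · rw [notMem_support_iff.mp hmS]; exact zero_mem _
  -- the relation `Σ_{m ∈ S} x^m • P_m = 0`, indexed by the finite type `↥S`
  let f : ↥S → A := fun i => eval x (monomial i.1 (1 : A))
  let v : ↥S → B := fun i => P.coeff i.1
  have hmon : ∀ m' : Fin d →₀ ℕ, eval (algebraMap A B ∘ x) (monomial m' (1 : B)) =
      algebraMap A B (eval x (monomial m' (1 : A))) := fun m' => by
    rw [algebraMap_eval, map_monomial, (algebraMap A B).map_one]
  have hrel : ∑ i : ↥S, f i • v i = 0 := by
    have h1 : ∑ i : ↥S, f i • v i = ∑ m' ∈ S, P.coeff m' * eval (algebraMap A B ∘ x) (monomial m' (1 : B)) := by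
      rw [← Finset.sum_coe_sort S]
      refine Finset.sum_congr rfl fun i _ => ?_
      rw [Algebra.smul_def, hmon, mul_comm]
    rw [h1, ← h0]
    conv_rhs => rw [P.as_sum, map_sum]
    exact (Finset.sum_congr rfl fun m' _ => (eval_monomial_eq _ m' _).symm)
  obtain ⟨k, a, y, hv, hf⟩ := Module.Flat.isTrivialRelation_of_sum_smul_eq_zero hrel
  -- every `A`-coefficient of the trivialisation lies in `𝔪_A`
  have ha : ∀ (i : ↥S) (j : Fin k), a i j ∈ maximalIdeal A := by
    intro i₀ j
    set Q : MvPolynomial (Fin d) A := ∑ i : ↥S, monomial i.1 (a i j) with hQdef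
    have hdeg : ∀ i : ↥S, (i.1).degree = n := fun i => by
      rw [Finsupp.degree_eq_weight_one]
      exact hP (mem_support_iff.mp i.2)
    have hQ : Q.IsHomogeneous n := IsHomogeneous.sum _ _ _ fun i _ => isHomogeneous_monomial _ (hdeg i)
    have hQ0 : eval x Q = 0 := by
      rw [hQdef, map_sum, ← hf j]
      refine Finset.sum_congr rfl fun i _ => ?_
      rw [eval_monomial_eq, mul_comm]
    have hcoeff := coeff_mem_maximalIdeal_of_eval_mem_pow hd x hx hQ (by rw [hQ0]; exact zero_mem _) i₀.1
    have hQi : Q.coeff i₀.1 = a i₀ j := by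
      rw [hQdef, coeff_sum]
      simp_rw [coeff_monomial]
      rw [Finset.sum_eq_single i₀ (fun i _ hi => if_neg fun e => hi (Subtype.ext e))
        (fun habs => absurd (Finset.mem_univ _) habs), if_pos rfl]
    rwa [hQi] at hcoeff
  -- hence `P_m = Σ_j φ(a_{mj}) y_j ∈ 𝔪_A B = 𝔪_B`
  have : P.coeff m = v ⟨m, hmS⟩ := rfl
  rw [this, hv]
  refine Ideal.sum_mem _ fun j _ => ?_
  rw [Algebra.smul_def]
  refine Ideal.mul_mem_right _ _ ?_
  rw [← hmap]
  exact Ideal.mem_map_of_mem _ (ha _ j)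

include hd hx hmap in
/-- The same with `P(x') ∈ 𝔪_B^{n+1}`: all coefficients of the degree-`n` form `P` lie in `𝔪_B` (`𝔪_B^{n+1} = 𝔪_B·(x')ⁿ`, so the
excess is a degree-`n` form with coefficients in `𝔪_B`). [cite: Matsumura1987, Thm. 17.10] -/
theorem coeff_mem_of_eval_mem_pow_succ [Module.Flat A B] {n : ℕ} {P : MvPolynomial (Fin d) B}
    (hP : P.IsHomogeneous n) (h : eval (algebraMap A B ∘ x) P ∈ maximalIdeal B ^ (n + 1)) (m : Fin d →₀ ℕ) :
    P.coeff m ∈ maximalIdeal B := by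
  have hx' := span_range_comp_eq x hx hmap
  have h' : eval (algebraMap A B ∘ x) P ∈ maximalIdeal B * Ideal.span (Set.range (algebraMap A B ∘ x)) ^ n := by
    rwa [hx', ← pow_succ']
  obtain ⟨H, hH, hHm, hHe⟩ := exists_isHomogeneous_of_mem_mul_span_pow (algebraMap A B ∘ x) (maximalIdeal B) n h'
  have h0 : eval (algebraMap A B ∘ x) (P - H) = 0 := by rw [map_sub, hHe, sub_self]
  have h1 := coeff_mem_of_eval_eq_zero hd x hx hmap (hP.sub hH) h0 m
  rw [coeff_sub] at h1
  have h2 : H.coeff m ∈ maximalIdeal B := (mem_map_C_iff.mp hHm) m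
  simpa using (maximalIdeal B).add_mem h1 h2

include hd hx hmap in
/-- **FAITHFUL FLATNESS ON POWERS**: `φ a ∈ 𝔪_Bⁿ ⇒ a ∈ 𝔪_Aⁿ`, i.e. `𝔪_Bⁿ ∩ A = 𝔪_Aⁿ` (induction on `n`, each step by
`coeff_mem_of_eval_mem_pow_succ`). [cite: Matsumura1987, Thm. 7.5] -/
theorem mem_pow_of_algebraMap_mem_pow [Module.Flat A B] (n : ℕ) :
    ∀ {a : A}, algebraMap A B a ∈ maximalIdeal B ^ n → a ∈ maximalIdeal A ^ n := by
  induction n with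
  | zero => intro a _; simp
  | succ n ih =>
    intro a ha
    have ha' : a ∈ maximalIdeal A ^ n := ih (Ideal.pow_le_pow_right n.le_succ ha)
    rw [← hx] at ha'
    obtain ⟨F, hF, hFa⟩ := exists_isHomogeneous_of_mem_span_pow x n ha'
    have hev : eval (algebraMap A B ∘ x) (map (algebraMap A B) F) ∈ maximalIdeal B ^ (n + 1) := by
      rwa [← algebraMap_eval, hFa]
    have hcoeff := coeff_mem_of_eval_mem_pow_succ hd x hx hmap (hF.map _) hev
    have hFm : F ∈ Ideal.map C (maximalIdeal A) := by
      rw [mem_map_C_iff]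
      intro m
      have := hcoeff m
      rw [coeff_map] at this
      exact mem_maximalIdeal_of_algebraMap_mem this
    have := eval_mem_mul_span_pow x hF hFm
    rwa [hFa, hx, ← pow_succ'] at this

end RSOP

/-! ## The discharge -/

/-- **`SquareDescent` HOLDS** (LEMMA SD, memo §12.2; res-L0-w41-tri-2 R-K7.4). Kernel proof = the memo's induction on the
`B`-order `j` of the error term, with `gr` replaced by quasi-regularity of a regular system of parameters in `A` (Matsumura 17.10)
transported to `B` by the equational criterion of flatness, faithful flatness on powers as its corollary, and the Frobenius twist in
characteristic `2`. OURS. [cite: Matsumura1987, Thm. 17.10, Thm. 16.2] -/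
theorem squareDescent_holds : SquareDescent := by
  intro A B _ _ _ _ _ _ _ hmap hres n f b hfb
  classical
  obtain ⟨x, hx⟩ := exists_regularSystemOfParameters (R := A)
  have hd : (maximalIdeal A).spanFinrank = (maximalIdeal A).spanFinrank := rfl
  have h2 : (2 : B) = 0 := by
    have h := congrArg (algebraMap A B) (CharP.cast_eq_zero A 2)
    rw [map_natCast, map_zero, Nat.cast_ofNat] at h
    exact h
  haveI : CharP B 2 := CharTwo.of_one_ne_zero_of_two_eq_zero one_ne_zero h2
  have hx' := span_range_comp_eq x hx hmap
  -- the invariant of the memo's induction: `φ f − φ a² − c² ∈ 𝔪_Bⁿ` with `c ∈ 𝔪_Bʲ`, for `2j ≤ n + 1`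
  have key : ∀ j : ℕ, 2 * j ≤ n + 1 → ∃ (a : A) (c : B), c ∈ maximalIdeal B ^ j ∧
      algebraMap A B f - algebraMap A B (a ^ 2) - c ^ 2 ∈ maximalIdeal B ^ n := by
    intro j
    induction j with
    | zero =>
      intro _
      exact ⟨0, b, by simp, by simpa using hfb⟩
    | succ j ih =>
      intro hj
      obtain ⟨a, c, hc, hinv⟩ := ih (by omega)
      -- `g = f − a²` has `φ g ≡ c²` mod `𝔪_Bⁿ ⊆ 𝔪_B^{2j+1}`, so `φ g ∈ 𝔪_B^{2j}` and `g ∈ 𝔪_A^{2j}` by faithful flatness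
      have hg1 : algebraMap A B (f - a ^ 2) - c ^ 2 ∈ maximalIdeal B ^ (2 * j + 1) := by
        rw [map_sub]
        exact Ideal.pow_le_pow_right (by omega) hinv
      have hc2 : c ^ 2 ∈ maximalIdeal B ^ (2 * j) := by
        have := Ideal.pow_mem_pow hc 2
        rwa [← pow_mul, mul_comm] at this
      have hφg : algebraMap A B (f - a ^ 2) ∈ maximalIdeal B ^ (2 * j) := by
        have := add_mem (Ideal.pow_le_pow_right (Nat.le_succ _) hg1) hc2
        simpa using this
      have hg : f - a ^ 2 ∈ Ideal.span (Set.range x) ^ (2 * j) := by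
        rw [hx]
        exact mem_pow_of_algebraMap_mem_pow hd x hx hmap (2 * j) hφg
      obtain ⟨F, hF, hFg⟩ := exists_isHomogeneous_of_mem_span_pow x (2 * j) hg
      have hc' : c ∈ Ideal.span (Set.range (algebraMap A B ∘ x)) ^ j := by rwa [hx']
      obtain ⟨H, hH, hHc⟩ := exists_isHomogeneous_of_mem_span_pow (algebraMap A B ∘ x) j hc'
      -- the Frobenius twist `T` of `H`: `T(x') = c²`, a form of degree `2j`
      set T : MvPolynomial (Fin _) B := ∑ m ∈ H.support, (monomial m (H.coeff m)) ^ 2 with hTdef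
      have hT : T.IsHomogeneous (2 * j) := isHomogeneous_twist hH
      have hTc : eval (algebraMap A B ∘ x) T = c ^ 2 := by
        rw [← hHc]
        exact (sq_eval_eq_eval_twist _ H).symm
      -- `(φ F − T)(x') = φ g − c² ∈ 𝔪_B^{2j+1}`: all coefficients of `φ F − T` lie in `𝔪_B`
      have hD : eval (algebraMap A B ∘ x) (map (algebraMap A B) F - T) ∈ maximalIdeal B ^ (2 * j + 1) := by
        rw [map_sub, ← algebraMap_eval, hFg, hTc]
        exact hg1
      have hcoef := coeff_mem_of_eval_mem_pow_succ hd x hx hmap ((hF.map _).sub hT) hD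
      -- residue square condition: `H_m ≡ φ α_m` mod `𝔪_B`
      have hsq : ∀ m : Fin _ →₀ ℕ, ∃ am : A, H.coeff m - algebraMap A B am ∈ maximalIdeal B := by
        intro m
        refine hres _ ⟨F.coeff (2 • m), ?_⟩
        have := hcoef (2 • m)
        rw [coeff_sub, coeff_map, hTdef, coeff_two_nsmul_twist] at this
        simpa using (maximalIdeal B).neg_mem this
      choose α hα using hsq
      set F₁ : MvPolynomial (Fin _) A := ∑ m ∈ H.support, monomial m (α m) with hF₁def
      have hdegH : ∀ m ∈ H.support, (m : Fin _ →₀ ℕ).degree = j := fun m hm => by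
        rw [Finsupp.degree_eq_weight_one]
        exact hH (mem_support_iff.mp hm)
      have hF₁ : F₁.IsHomogeneous j := IsHomogeneous.sum _ _ _ fun m hm => isHomogeneous_monomial _ (hdegH m hm)
      set a' : A := eval x F₁ with ha'def
      refine ⟨a + a', c - algebraMap A B a', ?_, ?_⟩
      · -- `c − φ a' = (H − φ F₁)(x') ∈ 𝔪_B · 𝔪_Bʲ`
        have hE : (H - map (algebraMap A B) F₁).IsHomogeneous j := hH.sub (hF₁.map _)
        have hEm : H - map (algebraMap A B) F₁ ∈ Ideal.map C (maximalIdeal B) := by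
          rw [mem_map_C_iff]
          intro m
          rw [coeff_sub, coeff_map]
          have hc1 : F₁.coeff m = if m ∈ H.support then α m else 0 := by
            rw [hF₁def, coeff_sum]
            simp_rw [coeff_monomial]
            rw [Finset.sum_ite_eq' H.support m α]
          rw [hc1]
          split_ifs with hm
          · exact hα m
          · rw [notMem_support_iff.mp hm, map_zero, sub_zero]
            exact zero_mem _
        have := eval_mem_mul_span_pow (algebraMap A B ∘ x) hE hEm
        rwa [map_sub, ← algebraMap_eval, hHc, hx', ← pow_succ'] at this
      · -- characteristic `2` keeps the invariant
        have e : algebraMap A B f - algebraMap A B ((a + a') ^ 2) - (c - algebraMap A B a') ^ 2 =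
            (algebraMap A B f - algebraMap A B (a ^ 2) - c ^ 2) +
              2 * (c * algebraMap A B a' - algebraMap A B a * algebraMap A B a' - algebraMap A B a' ^ 2) := by
          simp only [map_add, map_pow]
          ring
        rw [e, h2, zero_mul, add_zero]
        exact hinv
  -- at `j = ⌈n/2⌉`: `c² ∈ 𝔪_Bⁿ`, so `φ (f − a²) ∈ 𝔪_Bⁿ`, and faithful flatness finishes
  obtain ⟨a, c, hc, hinv⟩ := key ((n + 1) / 2) (Nat.mul_div_le (n + 1) 2)
  have hc2 : c ^ 2 ∈ maximalIdeal B ^ n := by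
    have := Ideal.pow_mem_pow hc 2
    rw [← pow_mul] at this
    exact Ideal.pow_le_pow_right (by omega) this
  have hfa : algebraMap A B (f - a ^ 2) ∈ maximalIdeal B ^ n := by
    rw [map_sub]
    have := add_mem hinv hc2
    simpa using this
  exact ⟨a, by simpa [hx] using mem_pow_of_algebraMap_mem_pow hd x hx hmap n hfa⟩

end Summit.ResolutionOfSingularities.ResolutionOfSingularities.Theorems.SwitchingDichotomy.SquareDescent
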